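import Summits.NavierStokesRegularity.NavierStokesRegularity.Theorems.TypeILiouvilleTypeIliouvilleLBackwardL3Liouville
import Summits.NavierStokesRegularity.NavierStokesRegularity.Theorems.AdaptedFrequencyFrequencyRigidityLiouvilleImpliesTypeI
import Literature.Analysis.FluidPDE.SteadyNSBoundedMild
import Literature.Analysis.FluidPDE.KNSSTypeIRateLiouvilleMild
import Literature.Analysis.FluidPDE.NSBoundedMildSmoothing
import HarnessLib

/-!
# The regime split of the crux `TypeIliouvilleL` is lossless, and its persistent half contains
# the bounded steady Liouville problem (stmt-NavierStokesRegularity-10661, line `registered`)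

Support file for the crux `TypeIliouvilleL` (= the Liouville conjecture (L) of
Koch–Nadirashvili–Seregin–Šverák 2009 over the tree's duality-form class
`Literature.Analysis.FluidPDE.IsBoundedAncientMildSolution`). The line's skeleton carries (L) as
two registered open stubs — (L') in the KNSS gauge (`stub_typeIAncientLiouville_knssGauge`,
verbatim the item stmt-NavierStokesRegularity-4050) and far-past `L³` recurrence to constants in
the persistent (non-Type-I) time regime (`stub_persistent_backward_L3_decay`, "S3") — whose
conjunction implies the crux (`TypeIliouvilleL_of_knssGauge_of_persistentL3`, landed). This file
certifies, kernel-checked, that nothing was lost and where the open content sits: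

* `persistentL3_iff_liouville_persistent` — S3 is EQUIVALENT to (L) restricted to the persistent
  class (→ is the landed backward-`L³` Liouville theorem `liouville_slices_of_backward_L3`;
  ← takes the slice constants as the drift and `M = 0`);
* `TypeIliouvilleL_iff_regimes`, `TypeIliouvilleL_iff_typeIRegime_and_persistentL3` — the crux is
  equivalent to the conjunction of its Type-I-regime half and its persistent half, the latter in
  either form;
* `persistentL3_of_TypeIliouvilleL`, `typeIAncientLiouville_knssGauge_of_TypeIliouvilleL` — each
  registered stub is implied by the crux (the second through the tree theorem
  `typeIAncientLiouville_of_liouvilleConjectureNS`, (L) ⇒ (L'));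
* `steady_bounded_const_of_persistentL3`, `steady_bounded_const_of_TypeIliouvilleL` — S3 alone
  (and a fortiori the crux) already implies the **bounded steady Liouville statement**: every
  smooth steady solution `(W, P)` of unforced Navier–Stokes on `ℝ³` with bounded velocity is
  constant (KNSS 2009 §1 p. 3: (L) "is open even in the steady-state case"). The steady field,
  viewed as the constant family `t ↦ W`, is a bounded ancient mild solution of the duality-form
  class (`IsSteadyClassicalNS.eq_heatExtension_sub_oseenDuhamel` + `isBoundedAncientMildSolution_of_oseen`);
  it is in the Type-I regime only if `W = 0` a.e.; otherwise S3 and the backward-`L³` theorem make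
  the slice a.e. constant, and continuity finishes.

No new definitions; theorems only.

## References

* G. Koch, N. Nadirashvili, G. Seregin, V. Šverák, *Liouville theorems for the Navier–Stokes
  equations and applications*, Acta Math. 203 (2009) 83–105 = arXiv:0709.3599, §1 p. 3
  (conjecture (L); the steady case is open), §4 (i)–(ii). [KochNadirashviliSereginSverak2009]
* D. Albritton, T. Barker, J. Math. Fluid Mech. 21 (2019) = arXiv:1811.00502, Thm 1.2.
  [AlbrittonBarker2019]
-/

-- the summit and its single problem share the name (D-0017 nested layout)
set_option linter.dupNamespace false

noncomputable section

open MeasureTheory Filter Set Function Metric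
open scoped Topology ENNReal

namespace Summit.NavierStokesRegularity.NavierStokesRegularity.Theorems

namespace TypeIliouvilleL.PersistentRegime

/-- A backward sequence of negative times: `τ_k = −(k+1) → −∞`. -/
theorem tendsto_neg_natCast_add_one_atBot :
    Tendsto (fun k : ℕ => -((k : ℝ) + 1)) atTop atBot :=
  tendsto_neg_atTop_atBot.comp (tendsto_atTop_add_const_right _ 1 tendsto_natCast_atTop_atTop)

/-- A slice which is a.e. a constant is at `L³`-distance `0` from that constant. -/
theorem eLpNorm_sub_const_eq_zero_of_ae_eq {f : EuclideanSpace ℝ (Fin 3) → EuclideanSpace ℝ (Fin 3)}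
    {b : EuclideanSpace ℝ (Fin 3)} (h : f =ᵐ[volume] fun _ => b) :
    eLpNorm (fun x => f x - b) 3 (volume : Measure (EuclideanSpace ℝ (Fin 3))) = 0 := by
  have hae : (fun x => f x - b) =ᵐ[volume] (0 : EuclideanSpace ℝ (Fin 3) → EuclideanSpace ℝ (Fin 3)) := by
    filter_upwards [h] with x hx
    simp [hx]
  rw [eLpNorm_congr_ae hae, eLpNorm_zero]

/-- A bounded field obeying the Type-I bound `‖W x‖ ≤ C/√(−t)` a.e. at EVERY `t < 0` (as the
constant-in-time family) vanishes a.e.: let `t → −∞` along the integers. -/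
theorem ae_eq_zero_of_typeI_const {W : EuclideanSpace ℝ (Fin 3) → EuclideanSpace ℝ (Fin 3)} {C : ℝ}
    (h : ∀ t < 0, ∀ᵐ x ∂(volume : Measure (EuclideanSpace ℝ (Fin 3))), ‖W x‖ ≤ C / Real.sqrt (-t)) :
    W =ᵐ[volume] (0 : EuclideanSpace ℝ (Fin 3) → EuclideanSpace ℝ (Fin 3)) := by
  have hall : ∀ᵐ x ∂(volume : Measure (EuclideanSpace ℝ (Fin 3))),
      ∀ n : ℕ, ‖W x‖ ≤ C / Real.sqrt ((n : ℝ) + 1) := by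
    rw [ae_all_iff]
    intro n
    have hn : (-((n : ℝ) + 1)) < 0 := by
      have : (0 : ℝ) ≤ n := Nat.cast_nonneg n
      linarith
    have := h (-((n : ℝ) + 1)) hn
    simpa [neg_neg] using this
  filter_upwards [hall] with x hx
  have hlim : Tendsto (fun n : ℕ => C / Real.sqrt ((n : ℝ) + 1)) atTop (𝓝 0) := by
    have h1 : Tendsto (fun n : ℕ => Real.sqrt ((n : ℝ) + 1)) atTop atTop :=
      Real.tendsto_sqrt_atTop.comp (tendsto_atTop_add_const_right _ 1 tendsto_natCast_atTop_atTop)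
    exact h1.const_div_atTop C
  have hle : ‖W x‖ ≤ 0 := ge_of_tendsto' hlim fun n => hx n
  simpa using le_antisymm hle (norm_nonneg _)

/-- A continuous field a.e. equal to a constant is that constant everywhere. -/
theorem eq_const_of_ae_eq_const {W : EuclideanSpace ℝ (Fin 3) → EuclideanSpace ℝ (Fin 3)}
    (hW : Continuous W) {b : EuclideanSpace ℝ (Fin 3)} (h : W =ᵐ[volume] fun _ => b) :
    ∀ x, W x = b := by
  have : W = fun _ => b := (Continuous.ae_eq_iff_eq volume hW continuous_const).1 h
  exact fun x => congrFun this x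

/-- **Bounded steady flows are bounded ancient mild solutions (duality form).** A smooth steady
solution `(W, P)` of unforced Navier–Stokes on `ℝ³` (`ν = 1`) with `‖W‖ ≤ M`, viewed as the
constant family `t ↦ W`, lies in `IsBoundedAncientMildSolution 1` and has continuous (hence
a.e.-strongly measurable) slices: bounded steady flows solve Oseen's integral equation from their
own datum (`IsSteadyClassicalNS.eq_heatExtension_sub_oseenDuhamel`), the Duhamel term is
translated in time (`oseenDuhamel_translate`), and Oseen-mild bounded continuous ancient fields
are duality-mild (`isBoundedAncientMildSolution_of_oseen`). -/
theorem isBoundedAncientMildSolution_const_of_steady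
    {W : EuclideanSpace ℝ (Fin 3) → EuclideanSpace ℝ (Fin 3)} {P : EuclideanSpace ℝ (Fin 3) → ℝ}
    (h : Literature.Analysis.FluidPDE.IsSteadyClassicalNS 1 0 W P) {M : ℝ} (hM : ∀ x, ‖W x‖ ≤ M) :
    Literature.Analysis.FluidPDE.IsBoundedAncientMildSolution 1 (fun _ : ℝ => W) := by
  have hWc : Continuous W := h.smooth_velocity.continuous
  refine Literature.Analysis.FluidPDE.isBoundedAncientMildSolution_of_oseen one_pos ?_
    ⟨M, fun _ _ x => hM x⟩ ?_ ?_
  · exact (hWc.comp continuous_snd).continuousOn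
  · intro t _
    exact Literature.Analysis.FluidPDE.VectorCalculus.IsDivFree.isWeaklyDivFree_holds h.divFree
      (h.smooth_velocity.of_le (by exact_mod_cast le_top))
  · intro s t hst _ x
    rw [one_mul, h.eq_heatExtension_sub_oseenDuhamel hM (sub_pos.2 hst) x]
    have h2 := Literature.Analysis.FluidPDE.oseenDuhamel_translate 1 0 s
      (fun _ : ℝ => W) (fun _ : ℝ => W) (t - s) x
    simp only [zero_add, sub_add_cancel] at h2
    rw [h2]

end TypeIliouvilleL.PersistentRegime

open TypeIliouvilleL.PersistentRegime

/-- **S3 ⟺ (L) on the persistent class.** Far-past `L³` recurrence to constants for every bounded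
ancient mild solution outside the Type-I time regime (the registered stub
`stub_persistent_backward_L3_decay` of the line) is EQUIVALENT to the Liouville conclusion of (L)
for the same class: → is the landed backward-`L³` Liouville theorem
`liouville_slices_of_backward_L3` (Oseen gauge + Albritton–Barker 2019 Thm 1.2); ← takes as drift
the slice constants themselves, along `τ_k = −(k+1)`, with `M = 0`. -/
theorem persistentL3_iff_liouville_persistent :
    (∀ u : ℝ → EuclideanSpace ℝ (Fin 3) → EuclideanSpace ℝ (Fin 3),
      Literature.Analysis.FluidPDE.IsBoundedAncientMildSolution 1 u →
      (∀ t < 0, AEStronglyMeasurable (u t) volume) →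
      (¬ ∃ C : ℝ, ∀ t < 0, ∀ᵐ x ∂(volume : Measure (EuclideanSpace ℝ (Fin 3))),
          ‖u t x‖ ≤ C / Real.sqrt (-t)) →
      ∃ (b : ℝ → EuclideanSpace ℝ (Fin 3)) (τ : ℕ → ℝ) (M : NNReal),
          (∀ k, τ k < 0) ∧ Tendsto τ atTop atBot ∧
          ∀ k, eLpNorm (fun x => u (τ k) x - b (τ k)) 3
            (volume : Measure (EuclideanSpace ℝ (Fin 3))) ≤ (M : ENNReal)) ↔
    (∀ u : ℝ → EuclideanSpace ℝ (Fin 3) → EuclideanSpace ℝ (Fin 3),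
      Literature.Analysis.FluidPDE.IsBoundedAncientMildSolution 1 u →
      (∀ t < 0, AEStronglyMeasurable (u t) volume) →
      (¬ ∃ C : ℝ, ∀ t < 0, ∀ᵐ x ∂(volume : Measure (EuclideanSpace ℝ (Fin 3))),
          ‖u t x‖ ≤ C / Real.sqrt (-t)) →
      ∀ t < 0, ∃ b : EuclideanSpace ℝ (Fin 3), u t =ᵐ[volume] fun _ => b) := by
  constructor
  · intro h u hu hmeas hpers
    exact liouville_slices_of_backward_L3 u hu hmeas (h u hu hmeas hpers)
  · intro h u hu hmeas hpers
    have hL := h u hu hmeas hpers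
    classical
    refine ⟨fun t => if ht : t < 0 then Classical.choose (hL t ht) else 0,
      fun k => -((k : ℝ) + 1), 0, fun k => ?_, tendsto_neg_natCast_add_one_atBot, fun k => ?_⟩
    · have : (0 : ℝ) ≤ k := Nat.cast_nonneg k
      linarith
    · have hk : (-((k : ℝ) + 1)) < 0 := by
        have : (0 : ℝ) ≤ k := Nat.cast_nonneg k
        linarith
      have hb := Classical.choose_spec (hL (-((k : ℝ) + 1)) hk)
      simp only [dif_pos hk]
      rw [eLpNorm_sub_const_eq_zero_of_ae_eq hb]
      exact bot_le

/-- **The regime split is lossless**: the crux `TypeIliouvilleL` is equivalent to the conjunction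
of (L) on the Type-I time regime and (L) on the persistent regime (pure logic: excluded middle on
the regime). -/
theorem TypeIliouvilleL_iff_regimes :
    Summit.NavierStokesRegularity.NavierStokesRegularity.Theses.TypeILiouville.TypeIliouvilleL ↔
    ((∀ u : ℝ → EuclideanSpace ℝ (Fin 3) → EuclideanSpace ℝ (Fin 3),
      Literature.Analysis.FluidPDE.IsBoundedAncientMildSolution 1 u →
      (∀ t < 0, AEStronglyMeasurable (u t) volume) →
      (∃ C : ℝ, ∀ t < 0, ∀ᵐ x ∂(volume : Measure (EuclideanSpace ℝ (Fin 3))),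
          ‖u t x‖ ≤ C / Real.sqrt (-t)) →
      ∀ t < 0, ∃ b : EuclideanSpace ℝ (Fin 3), u t =ᵐ[volume] fun _ => b) ∧
    (∀ u : ℝ → EuclideanSpace ℝ (Fin 3) → EuclideanSpace ℝ (Fin 3),
      Literature.Analysis.FluidPDE.IsBoundedAncientMildSolution 1 u →
      (∀ t < 0, AEStronglyMeasurable (u t) volume) →
      (¬ ∃ C : ℝ, ∀ t < 0, ∀ᵐ x ∂(volume : Measure (EuclideanSpace ℝ (Fin 3))),
          ‖u t x‖ ≤ C / Real.sqrt (-t)) →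
      ∀ t < 0, ∃ b : EuclideanSpace ℝ (Fin 3), u t =ᵐ[volume] fun _ => b)) := by
  constructor
  · intro hL
    exact ⟨fun u hu hmeas _ => hL u hu hmeas, fun u hu hmeas _ => hL u hu hmeas⟩
  · rintro ⟨hI, hP⟩ u hu hmeas
    by_cases hreg : ∃ C : ℝ, ∀ t < 0, ∀ᵐ x ∂(volume : Measure (EuclideanSpace ℝ (Fin 3))),
        ‖u t x‖ ≤ C / Real.sqrt (-t)
    · exact hI u hu hmeas hreg
    · exact hP u hu hmeas hreg

/-- **The crux is equivalent to "Type-I-regime Liouville ∧ S3"** (S3 = the registered stub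
`stub_persistent_backward_L3_decay`): combine `TypeIliouvilleL_iff_regimes` with
`persistentL3_iff_liouville_persistent`. -/
theorem TypeIliouvilleL_iff_typeIRegime_and_persistentL3 :
    Summit.NavierStokesRegularity.NavierStokesRegularity.Theses.TypeILiouville.TypeIliouvilleL ↔
    ((∀ u : ℝ → EuclideanSpace ℝ (Fin 3) → EuclideanSpace ℝ (Fin 3),
      Literature.Analysis.FluidPDE.IsBoundedAncientMildSolution 1 u →
      (∀ t < 0, AEStronglyMeasurable (u t) volume) →
      (∃ C : ℝ, ∀ t < 0, ∀ᵐ x ∂(volume : Measure (EuclideanSpace ℝ (Fin 3))),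
          ‖u t x‖ ≤ C / Real.sqrt (-t)) →
      ∀ t < 0, ∃ b : EuclideanSpace ℝ (Fin 3), u t =ᵐ[volume] fun _ => b) ∧
    (∀ u : ℝ → EuclideanSpace ℝ (Fin 3) → EuclideanSpace ℝ (Fin 3),
      Literature.Analysis.FluidPDE.IsBoundedAncientMildSolution 1 u →
      (∀ t < 0, AEStronglyMeasurable (u t) volume) →
      (¬ ∃ C : ℝ, ∀ t < 0, ∀ᵐ x ∂(volume : Measure (EuclideanSpace ℝ (Fin 3))),
          ‖u t x‖ ≤ C / Real.sqrt (-t)) →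
      ∃ (b : ℝ → EuclideanSpace ℝ (Fin 3)) (τ : ℕ → ℝ) (M : NNReal),
          (∀ k, τ k < 0) ∧ Tendsto τ atTop atBot ∧
          ∀ k, eLpNorm (fun x => u (τ k) x - b (τ k)) 3
            (volume : Measure (EuclideanSpace ℝ (Fin 3))) ≤ (M : ENNReal))) := by
  rw [TypeIliouvilleL_iff_regimes, persistentL3_iff_liouville_persistent]

/-- **The crux implies the registered stub S3** (`stub_persistent_backward_L3_decay`). -/
theorem persistentL3_of_TypeIliouvilleL
    (hL : Summit.NavierStokesRegularity.NavierStokesRegularity.Theses.TypeILiouville.TypeIliouvilleL) :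
    ∀ u : ℝ → EuclideanSpace ℝ (Fin 3) → EuclideanSpace ℝ (Fin 3),
      Literature.Analysis.FluidPDE.IsBoundedAncientMildSolution 1 u →
      (∀ t < 0, AEStronglyMeasurable (u t) volume) →
      (¬ ∃ C : ℝ, ∀ t < 0, ∀ᵐ x ∂(volume : Measure (EuclideanSpace ℝ (Fin 3))),
          ‖u t x‖ ≤ C / Real.sqrt (-t)) →
      ∃ (b : ℝ → EuclideanSpace ℝ (Fin 3)) (τ : ℕ → ℝ) (M : NNReal),
          (∀ k, τ k < 0) ∧ Tendsto τ atTop atBot ∧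
          ∀ k, eLpNorm (fun x => u (τ k) x - b (τ k)) 3
            (volume : Measure (EuclideanSpace ℝ (Fin 3))) ≤ (M : ENNReal) :=
  (TypeIliouvilleL_iff_typeIRegime_and_persistentL3.1 hL).2

/-- **The crux implies the registered stub (L') in the KNSS gauge**
(`stub_typeIAncientLiouville_knssGauge`, verbatim
`Summit.NavierStokesRegularity.NavierStokesRegularity.Theses.ExtremalTypeIConstant.TypeIAncientLiouville`,
stmt-NavierStokesRegularity-4050): the tree theorem `typeIAncientLiouville_of_liouvilleConjectureNS`
((L) ⇒ (L'); the crux and `LiouvilleConjectureNS` are definitionally equal). Together with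
`persistentL3_of_TypeIliouvilleL` and the landed `TypeIliouvilleL_of_knssGauge_of_persistentL3`
this shows the skeleton's two stubs are jointly EQUIVALENT to the crux. -/
theorem typeIAncientLiouville_knssGauge_of_TypeIliouvilleL
    (hL : Summit.NavierStokesRegularity.NavierStokesRegularity.Theses.TypeILiouville.TypeIliouvilleL) :
    ∀ (C : ℝ) (u : ℝ → EuclideanSpace ℝ (Fin 3) → EuclideanSpace ℝ (Fin 3)),
      ContDiffOn ℝ (⊤ : ℕ∞) (Function.uncurry u) (Set.Iio 0 ×ˢ Set.univ) ∧
      (∀ t < 0, Literature.Analysis.FluidPDE.VectorCalculus.IsDivFree (u t)) ∧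
      (∀ s t : ℝ, s < t → t < 0 → ∀ x,
        u t x = Literature.Analysis.FluidPDE.heatFlow (u s) (t - s) x -
          ∫ τ in Set.Ioo s t, ∫ y,
            Literature.Analysis.FluidPDE.oseenKernel (t - τ) (x - y) (u τ y) (u τ y)) ∧
      Literature.Analysis.FluidPDE.HasTypeITimeDecay C u →
      ∀ t < 0, ∀ x, u t x = 0 :=
  FrequencyRigidity.TwoEndedPinning.typeIAncientLiouville_of_liouvilleConjectureNS hL

/-- **The crux and its two registered stubs are equivalent** (lossless skeleton): `TypeIliouvilleL`
holds iff both (L') in the KNSS gauge and S3 hold. -/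
theorem TypeIliouvilleL_iff_knssGauge_and_persistentL3 :
    Summit.NavierStokesRegularity.NavierStokesRegularity.Theses.TypeILiouville.TypeIliouvilleL ↔
    ((∀ (C : ℝ) (u : ℝ → EuclideanSpace ℝ (Fin 3) → EuclideanSpace ℝ (Fin 3)),
      ContDiffOn ℝ (⊤ : ℕ∞) (Function.uncurry u) (Set.Iio 0 ×ˢ Set.univ) ∧
      (∀ t < 0, Literature.Analysis.FluidPDE.VectorCalculus.IsDivFree (u t)) ∧
      (∀ s t : ℝ, s < t → t < 0 → ∀ x,
        u t x = Literature.Analysis.FluidPDE.heatFlow (u s) (t - s) x -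
          ∫ τ in Set.Ioo s t, ∫ y,
            Literature.Analysis.FluidPDE.oseenKernel (t - τ) (x - y) (u τ y) (u τ y)) ∧
      Literature.Analysis.FluidPDE.HasTypeITimeDecay C u →
      ∀ t < 0, ∀ x, u t x = 0) ∧
    (∀ u : ℝ → EuclideanSpace ℝ (Fin 3) → EuclideanSpace ℝ (Fin 3),
      Literature.Analysis.FluidPDE.IsBoundedAncientMildSolution 1 u →
      (∀ t < 0, AEStronglyMeasurable (u t) volume) →
      (¬ ∃ C : ℝ, ∀ t < 0, ∀ᵐ x ∂(volume : Measure (EuclideanSpace ℝ (Fin 3))),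
          ‖u t x‖ ≤ C / Real.sqrt (-t)) →
      ∃ (b : ℝ → EuclideanSpace ℝ (Fin 3)) (τ : ℕ → ℝ) (M : NNReal),
          (∀ k, τ k < 0) ∧ Tendsto τ atTop atBot ∧
          ∀ k, eLpNorm (fun x => u (τ k) x - b (τ k)) 3
            (volume : Measure (EuclideanSpace ℝ (Fin 3))) ≤ (M : ENNReal))) :=
  ⟨fun hL => ⟨typeIAncientLiouville_knssGauge_of_TypeIliouvilleL hL, persistentL3_of_TypeIliouvilleL hL⟩,
    fun h => TypeIliouvilleL_of_knssGauge_of_persistentL3 h.1 h.2⟩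

/-- **S3 contains the bounded steady Liouville problem.** If far-past `L³` recurrence to constants
holds for every bounded ancient mild solution outside the Type-I regime (the registered stub
`stub_persistent_backward_L3_decay`), then every smooth steady solution `(W, P)` of the unforced
Navier–Stokes system on `ℝ³` (`ν = 1`) with bounded velocity is constant — the steady case of
(L), open in print (KNSS 2009 §1 p. 3). The constant family `t ↦ W` is a bounded ancient mild
solution with continuous slices (`isBoundedAncientMildSolution_const_of_steady`); if it lies in the
Type-I regime then `W = 0` a.e. (`ae_eq_zero_of_typeI_const`), otherwise S3 and the landed
backward-`L³` Liouville theorem make the slice a.e. constant; continuity of `W` concludes.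
[cite: KochNadirashviliSereginSverak2009, §1 p. 3 (arXiv:0709.3599)] -/
theorem steady_bounded_const_of_persistentL3 :
    (∀ u : ℝ → EuclideanSpace ℝ (Fin 3) → EuclideanSpace ℝ (Fin 3),
      Literature.Analysis.FluidPDE.IsBoundedAncientMildSolution 1 u →
      (∀ t < 0, AEStronglyMeasurable (u t) volume) →
      (¬ ∃ C : ℝ, ∀ t < 0, ∀ᵐ x ∂(volume : Measure (EuclideanSpace ℝ (Fin 3))),
          ‖u t x‖ ≤ C / Real.sqrt (-t)) →
      ∃ (b : ℝ → EuclideanSpace ℝ (Fin 3)) (τ : ℕ → ℝ) (M : NNReal),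
          (∀ k, τ k < 0) ∧ Tendsto τ atTop atBot ∧
          ∀ k, eLpNorm (fun x => u (τ k) x - b (τ k)) 3
            (volume : Measure (EuclideanSpace ℝ (Fin 3))) ≤ (M : ENNReal)) →
    ∀ (W : EuclideanSpace ℝ (Fin 3) → EuclideanSpace ℝ (Fin 3)) (P : EuclideanSpace ℝ (Fin 3) → ℝ),
      Literature.Analysis.FluidPDE.IsSteadyClassicalNS 1 0 W P →
      (∃ M : ℝ, ∀ x, ‖W x‖ ≤ M) → ∃ b : EuclideanSpace ℝ (Fin 3), ∀ x, W x = b := by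
  intro hS3 W P hW hbdd
  obtain ⟨M, hM⟩ := hbdd
  have hWc : Continuous W := hW.smooth_velocity.continuous
  set u : ℝ → EuclideanSpace ℝ (Fin 3) → EuclideanSpace ℝ (Fin 3) := fun _ => W with hu_def
  have hu : Literature.Analysis.FluidPDE.IsBoundedAncientMildSolution 1 u :=
    isBoundedAncientMildSolution_const_of_steady hW hM
  have hmeas : ∀ t < 0, AEStronglyMeasurable (u t) volume := fun _ _ =>
    hWc.aestronglyMeasurable
  have hslice : ∀ t, u t = W := fun _ => rfl
  by_cases hreg : ∃ C : ℝ, ∀ t < 0, ∀ᵐ x ∂(volume : Measure (EuclideanSpace ℝ (Fin 3))),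
      ‖u t x‖ ≤ C / Real.sqrt (-t)
  · obtain ⟨C, hC⟩ := hreg
    have hC' : ∀ t < 0, ∀ᵐ x ∂(volume : Measure (EuclideanSpace ℝ (Fin 3))),
        ‖W x‖ ≤ C / Real.sqrt (-t) := fun t ht => by
      have h := hC t ht
      rwa [hslice t] at h
    have h0 : W =ᵐ[volume] (0 : EuclideanSpace ℝ (Fin 3) → EuclideanSpace ℝ (Fin 3)) :=
      ae_eq_zero_of_typeI_const hC'
    have h0' : W =ᵐ[volume] fun _ => (0 : EuclideanSpace ℝ (Fin 3)) := h0
    exact ⟨0, eq_const_of_ae_eq_const hWc h0'⟩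
  · have hrec := hS3 u hu hmeas hreg
    have hm1 : (-1 : ℝ) < 0 := by norm_num
    obtain ⟨b, hb⟩ := liouville_slices_of_backward_L3 u hu hmeas hrec (-1) hm1
    have hb' : W =ᵐ[volume] fun _ => b := by rwa [hslice (-1)] at hb
    exact ⟨b, eq_const_of_ae_eq_const hWc hb'⟩

/-- **The crux contains the bounded steady Liouville problem**: under `TypeIliouvilleL` every
smooth steady solution of unforced Navier–Stokes on `ℝ³` (`ν = 1`) with bounded velocity is
constant (the slice `t = −1` of the constant family is a.e. constant, and `W` is continuous).
[cite: KochNadirashviliSereginSverak2009, §1 p. 3 (arXiv:0709.3599)] -/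
theorem steady_bounded_const_of_TypeIliouvilleL
    (hL : Summit.NavierStokesRegularity.NavierStokesRegularity.Theses.TypeILiouville.TypeIliouvilleL) :
    ∀ (W : EuclideanSpace ℝ (Fin 3) → EuclideanSpace ℝ (Fin 3)) (P : EuclideanSpace ℝ (Fin 3) → ℝ),
      Literature.Analysis.FluidPDE.IsSteadyClassicalNS 1 0 W P →
      (∃ M : ℝ, ∀ x, ‖W x‖ ≤ M) → ∃ b : EuclideanSpace ℝ (Fin 3), ∀ x, W x = b :=
  steady_bounded_const_of_persistentL3 (persistentL3_of_TypeIliouvilleL hL)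

end Summit.NavierStokesRegularity.NavierStokesRegularity.Theorems
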